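import Literature.Computability.AlgebraicComplexity.UABPToolkit
import HarnessLib

/-!
# DDS 2021, proof of Thm. 3.2, the last step: from `Φ(f) mod z^d` as a quotient of ABPs to an ABP for `f`

Theorem-only file (cell `val-lit`, row X2-DDS21, brick B5 "trace back `f_0`", the step `j = 0`;
memo HOME/np/MEMO-t18g10-DDS21-B5-traceback.md §3). Source: P. Dutta, P. Dwivedi, N. Saxena,
*Demystifying the border of depth-3 algebraic circuits*, FOCS 2021 / full version
[DuttaDwivediSaxena2022] (held text `paper:galaxy-pdf-7641649743695546420`), proof of Thm. 3.2,
"Size blowup", p0036 L957–961: "This gives `S_0 = s^{O(k 7^k)}`, which is the size of `Φ(f)`, over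
`F(z, x)`, being computed as an ABP/ABP. Using the degree bound on `z`, eliminate the division as in
the proof of Claim 3.7 to obtain an `ε`-free ABP over `F[x, z]` computing `Φ(f)`. Apply the map
`Φ^{-1}` to obtain the final ABP of size `s^{O(k 7^k)}` computing the polynomial `f`."

In the frame of `UABPToolkit.lean` (`z` = variable `0` of `MvPolynomial (Fin (n+1)) F`, the `x_i`
re-indexed by `Fin.succ`; "mod `z^d`" = `Literature.RingTheory.MvPolynomial.truncDegreeOf 0 d`), the
output of the trace-back recursion at `j = 0` is a pair of ABP-computed polynomials
`Num ∈ F[z, x]`, `den ∈ F[x] ∖ {0}` with `den · Φ(f) ≡ Num (mod z^d)` where `deg f < d`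
(p0028 L745–746: "assume that `deg(f_0) < d_0 := d`"). This file proves that such data yield an ABP
for `f` with one polynomial budget (`uabpComputes_of_phi_truncDegreeOf_eq`): the congruence is an
EQUALITY because both sides have `z`-degree `< d` (`degreeOf_zero_aeval_phi_le`:
`deg_z Φ(f) ≤ deg f`), then division elimination (`UABPComputes.divElim_of_infinite`, DDS Lemma 2.6)
and `Φ^{-1}` (`UABPComputes.of_aeval_phi`). 0 definitions, 0 named facts.

Honest framing: this is the assembly of the last three printed sentences of the proof of Thm. 3.2
on top of the toolkit; `DDS2021_thm_3_2` itself (the DiDIL induction producing `Num`, `den`)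
remains OPEN by name; `VP ≠ VNP` is NOT proved and nothing here bears on it.
-/

open MvPolynomial
open Literature.RingTheory.MvPolynomial

namespace Literature.Computability.AlgebraicComplexity

namespace DDS2021

section ZDegree

variable {F : Type*} [CommSemiring F] {n : ℕ}

/-- The image of a polynomial in `x` under the re-indexing `x_i ↦ x_{i+1}` does not involve
`z = x_0`. [cite: DuttaDwivediSaxena2022, §3 proof of Thm. 3.2, "Φ homomorphism" (full version p0028 L751–757)] -/
theorem degreeOf_zero_rename_succ (p : MvPolynomial (Fin n) F) :
    (rename Fin.succ p).degreeOf 0 = 0 := by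
  classical
  by_contra h
  have hmem : (0 : Fin (n + 1)) ∈ (rename Fin.succ p).vars := mem_vars_iff_degreeOf_ne_zero.2 h
  have := vars_rename Fin.succ p hmem
  simp only [Finset.mem_image] at this
  obtain ⟨i, -, hi⟩ := this
  exact Fin.succ_ne_zero i hi

/-- **The `z`-degree of `Φ(f)` is at most `deg f`** (`Φ : x_i ↦ z · x_i + α_i`; each monomial `x^m`
becomes `∏ (z x_{i+1} + α_i)^{m_i}`, of `z`-degree `|m|`) — "Using the degree bound on `z`".
[cite: DuttaDwivediSaxena2022, §3 proof of Thm. 3.2 (full version p0028 L756–757, p0036 L959)] -/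
theorem degreeOf_zero_aeval_phi_le (f : MvPolynomial (Fin n) F) (α : Fin n → F) :
    (aeval (fun i : Fin n => (X 0 * X i.succ + C (α i) : MvPolynomial (Fin (n + 1)) F)) f).degreeOf 0
      ≤ f.totalDegree := by
  classical
  have hφ : ∀ i : Fin n,
      (X 0 * X i.succ + C (α i) : MvPolynomial (Fin (n + 1)) F).degreeOf 0 ≤ 1 := by
    intro i
    refine (degreeOf_add_le _ _ _).trans (max_le ?_ (by rw [degreeOf_C]; exact Nat.zero_le _))
    rcases subsingleton_or_nontrivial F with hF | hF
    · have h0 : (X 0 * X i.succ : MvPolynomial (Fin (n + 1)) F) = 0 := Subsingleton.elim _ _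
      rw [h0, ← C_0, degreeOf_C]
      exact Nat.zero_le _
    · refine (degreeOf_mul_le _ _ _).trans ?_
      rw [degreeOf_X, degreeOf_X, if_pos rfl, if_neg (Fin.succ_ne_zero i).symm]
  rw [aeval_eq_bind₁]
  conv_lhs => rw [f.as_sum]
  rw [map_sum]
  refine (degreeOf_sum_le _ _ _).trans (Finset.sup_le fun d hd => ?_)
  rw [bind₁_monomial]
  refine (degreeOf_C_mul_le _ _ _).trans ?_
  refine (degreeOf_prod_le _ _ _).trans ?_
  refine le_trans (Finset.sum_le_sum fun i _ => (degreeOf_pow_le _ _ _).trans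
    (Nat.mul_le_mul_left _ (hφ i))) ?_
  simpa [Finsupp.sum] using le_totalDegree hd

end ZDegree

section FinalStep

/-- Substituting polynomials of degree `≤ e` multiplies the total degree by at most `e`.
[folklore] -/
private theorem totalDegree_bind₁_le_mul' {R : Type*} [CommSemiring R] {σ τ : Type*}
    (φ : σ → MvPolynomial τ R) {e : ℕ} (hφ : ∀ i, (φ i).totalDegree ≤ e) (f : MvPolynomial σ R) :
    (bind₁ φ f).totalDegree ≤ f.totalDegree * e := by
  classical
  conv_lhs => rw [f.as_sum]
  rw [map_sum]
  refine (totalDegree_finsetSum _ _).trans (Finset.sup_le fun d hd => ?_)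
  rw [bind₁_monomial]
  refine (totalDegree_mul _ _).trans ?_
  rw [totalDegree_C, zero_add]
  refine (totalDegree_finsetProd _ _).trans ?_
  refine le_trans (Finset.sum_le_sum fun i _ => (totalDegree_pow _ _).trans
    (Nat.mul_le_mul_left _ (hφ i))) ?_
  rw [← Finset.sum_mul]
  exact Nat.mul_le_mul_right _ (by simpa [Finsupp.sum] using le_totalDegree hd)

variable {F : Type*} [Field F] [CharZero F] {n : ℕ}

/-- **DDS Thm. 3.2, last step of the proof** (p0036 L957–961), on the toolkit: if `den · Φ(f) ≡ Num
(mod z^d)` with `deg f < d`, `den ∈ F[x] ∖ {0}` and `Num ∈ F[z, x]` computed by ABPs within budgets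
`S₂`, `S₁`, then `f` is computed by an ABP within budget `100 · s^5` for every `s ≥ 2` dominating
`d · (S₁ · d) + 2`, `S₂` and `2 d`. Route: both sides of the congruence have `z`-degree `< d`, so
they are EQUAL (`eq_of_truncDegreeOf_eq`); "eliminate the division" (`UABPComputes.divElim_of_infinite`,
Lemma 2.6) gives an ABP for `Φ(f)`; "apply the map `Φ^{-1}`" (`UABPComputes.of_aeval_phi`).
[cite: DuttaDwivediSaxena2022, §3 proof of Thm. 3.2, "Size blowup" (full version p0036 L957–961)] -/
theorem uabpComputes_of_phi_truncDegreeOf_eq {S₁ S₂ d s : ℕ} {f : MvPolynomial (Fin n) F}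
    (α : Fin n → F) {Num : MvPolynomial (Fin (n + 1)) F} {den : MvPolynomial (Fin n) F}
    (hNum : UABPComputes S₁ Num) (hden : UABPComputes S₂ den) (hden0 : den ≠ 0)
    (hcongr : truncDegreeOf 0 d (rename Fin.succ den *
        aeval (fun i : Fin n => (X 0 * X i.succ + C (α i) : MvPolynomial (Fin (n + 1)) F)) f) =
      truncDegreeOf 0 d Num)
    (hdeg : f.totalDegree < d) (hs : 2 ≤ s) (h1 : d * (S₁ * d) + 2 ≤ s) (h2 : S₂ ≤ s)
    (h3 : 2 * d ≤ s) : UABPComputes (100 * s ^ 5) f := by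
  classical
  set q : MvPolynomial (Fin (n + 1)) F :=
    aeval (fun i : Fin n => (X 0 * X i.succ + C (α i) : MvPolynomial (Fin (n + 1)) F)) f with hq_def
  set h : MvPolynomial (Fin (n + 1)) F := rename Fin.succ den with hh_def
  -- the congruence is an equality: both sides have `z`-degree `< d`
  have hdegq : q.degreeOf 0 < d := lt_of_le_of_lt (degreeOf_zero_aeval_phi_le f α) hdeg
  have hdeghq : (h * q).degreeOf 0 < d := by
    refine lt_of_le_of_lt (degreeOf_mul_le _ _ _) ?_
    rw [hh_def, degreeOf_zero_rename_succ, zero_add]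
    exact hdegq
  have heq : truncDegreeOf 0 d Num = h * q := by
    rw [← hcongr, truncDegreeOf_eq_self hdeghq]
  -- programs for `g := T_d Num` and `h`
  have hg : UABPComputes (d * (S₁ * d) + 2) (truncDegreeOf 0 d Num) := hNum.truncDegreeOf 0 d
  have hh : UABPComputes S₂ h := hden.rename Fin.succ
  have hh0 : h ≠ 0 := by
    rw [hh_def]
    exact fun h0 => hden0 (rename_injective _ (Fin.succ_injective n) (by rw [h0, map_zero]))
  -- degree of the quotient `q = Φ(f)`: `≤ 2 · deg f ≤ 2 d`
  have hqdeg : q.totalDegree ≤ 2 * d := by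
    have hφ : ∀ i : Fin n,
        (X 0 * X i.succ + C (α i) : MvPolynomial (Fin (n + 1)) F).totalDegree ≤ 2 := by
      intro i
      refine (totalDegree_add _ _).trans (max_le ?_ (by simp))
      refine (totalDegree_mul _ _).trans ?_
      rw [totalDegree_X, totalDegree_X]
    rw [hq_def, aeval_eq_bind₁]
    refine (totalDegree_bind₁_le_mul' _ hφ f).trans ?_
    omega
  -- division elimination (Lemma 2.6), then `Φ^{-1}`
  have hΦ : UABPComputes (100 * s ^ 5) q :=
    UABPComputes.divElim_of_infinite hg hh hh0 heq hqdeg hs h1 h2 h3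
  exact UABPComputes.of_aeval_phi α hΦ

end FinalStep

end DDS2021

end Literature.Computability.AlgebraicComplexity
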